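import Literature.AlgebraicGeometry.HodgeTheory.WeilClassesFourfolds
import Literature.AlgebraicGeometry.HodgeTheory.WeilClassesSixfolds
import Literature.AlgebraicGeometry.HodgeTheory.WeilClassesFourfoldsProofs
import HarnessLib

/-!
# Fact split: `Markman2025_weilClasses_algebraic_abelianFourfold` along Markman §11.5 Step 2

Family `hodge`, layer `Literature/AlgebraicGeometry/HodgeTheory`. The named fact
`Markman2025_weilClasses_algebraic_abelianFourfold` (file `WeilClassesFourfolds`; E. Markman,
arXiv:2509.23403 Thm. 1.2, fourfold half) hit the literature-prover budget cap as ONE statement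
(seat verdict: XL apex, statement faithful). This file DECOMPOSES it into the three intermediate
results of the printed proof, arXiv:2509.23403 §11.5 Step 2 (arXiv v2 PDF p. 21, lines 40–49 = v1 p. 21, lines 20–29; quoted from the held
TeX-derived corpus chunk p0019 — not a PDF page — whose "[schoen]" the PDF prints as "[S2, Prop. 10]"), verbatim:
"for every polarized abelian fourfold `(A₁,η₁,h₁)` of Weil type, of arbitrary discriminant, there
exists a polarized abelian surface of Weil type `(A₂,η₂,h₂)`, such that the discriminant of their
product polarized abelian sixfold of Weil type … is the coset of `-1`. The sixfold is hence of split
type and so its Weil classes are algebraic. It follows that the Weil classes of `(A₁,η₁,h₁)` are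
algebraic, by [schoen]."

1. (EXISTING named fact, not restated) `Markman2025_weilClasses_algebraic_hyperbolicSixfold`
   (file `WeilClassesSixfolds`; the same statement is also recorded as
   `Markman2025_weilClasses_algebraic_abelianSixfold_split`, file `WeilClassesSixfoldsSplit`):
   Markman arXiv:2502.03415 Thm. 1.5.1, the Weil classes of a SPLIT (= hyperbolic, discriminant
   `-1`, `Motives.IsHyperbolicWeilType`) abelian sixfold of Weil type are algebraic.
2. (NEW named fact) `Markman2025_exists_weilTypeSurface_prod_isHyperbolicWeilType`: the PARTNER
   SURFACE — for a fourfold `(A₁, φ₁)`, `φ₁² = -d`, whose Weil plane carries a non-zero rational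
   `(2,2)`-class (the carrier rendering of "of Weil type": otherwise `E± = ⋀⁴V±` have pure Hodge
   types `(p,4-p) ≠ (2,2)`), there is a surface `(A₂, φ₂)` of Weil type, `φ₂² = -d`, such that the
   product sixfold `(A₁ × A₂, φ₁ × φ₂)` is hyperbolic for a `K`-symmetrised hyperplane class
   (van Geemen LNM 1594 Lemma 5.2, 5.4 (Landherr), 5.5 "every class of `ℚ^×/Nm(K^×)` is a
   discriminant in every even dimension"; Schoen 1998 §7; Markman §11.5 Step 2 sentence 1
   "the discriminant invariant … is multiplicative under cartesian products" — the tree's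
   `Motives.weilDiscriminant_bilinOrthSum`, `Motives.exists_weilDiscriminant_eq`,
   `Motives.weilDiscriminant_eq_of_isotropic_rat` are the linear-algebra halves already landed).
3. (NEW named fact) `Schoen1998_weilClasses_algebraic_of_prod_surface`: SCHOEN'S TRANSFER,
   Compositio 114 (1998) §10 Proposition — if the rational `(3,3)` Weil classes of
   `(A₁ × A₂, φ₁ × φ₂)` are algebraic, `A₂` a surface of Weil type, then the rational `(2,2)` Weil
   classes of `(A₁, φ₁)` are algebraic. Proved on the carriers RELATIVE to a Gysin formalism, the
   Hodge-type predicates and Schoen's two transfer scalars by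
   `Markman2025_weilClasses_algebraic_abelianFourfold.pointwise_of_sixfold_partner`
   (file `WeilClassesFourfoldsStep2`); discharging it = supplying those on the carriers.

`Markman2025_weilClasses_algebraic_abelianFourfold_holds_of` PROVES the parent from 1–3 (case
`c = 0` trivial; else 2 gives the partner, 1 the sixfold input on `A₁ × A₂` —
`dim_prod_eq_two_mul`, `isSmoothProjective_prod_two_mul`, `prodLift_comp_self_eq_neg_nsmul` — and 3
returns to `A₁`). No child restates the parent: 1 is about sixfolds, 2 is an existence statement
about surfaces and discriminants, 3 is a transfer implication.

## References

* [Markman2025SurveySecant] E. Markman, Secant sheaves and Weil classes on abelian varieties,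
  arXiv:2509.23403, Thm. 1.2, §11.5 Step 2.
* [Markman2025SecantWeil] E. Markman, arXiv:2502.03415, Thm. 1.5.1, Cor. 1.6.1 (proof).
* [Schoen1998HodgeWeilAddendum] C. Schoen, Addendum to: Hodge classes on self-products of a variety
  with an automorphism, Compositio Math. 114 (1998) 329–336, §7, §10.
* [vanGeemen1994HodgeAV] B. van Geemen, LNM 1594 (1994), 4.9, Lemma 5.2, 5.4, 5.5, Thm. 6.12.
-/

noncomputable section

open CategoryTheory

namespace Literature.AlgebraicGeometry.HodgeTheory

open Literature.AlgebraicTopology.SingularHomology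

section HodgeTheory

/-- **Partner surface with split product (Markman arXiv:2509.23403 §11.5 Step 2, sentences 1–2;
van Geemen LNM 1594 Lemma 5.2, 5.4, 5.5; Schoen 1998 §7).** For `d ≥ 1` and a smooth projective
complex abelian fourfold `(A₁, φ₁)` with `φ₁ ≫ φ₁ = -(d • 𝟙 A₁)` whose Weil plane
`weilClassesOf A₁ φ₁ 2 d` contains a NON-ZERO rational class of Hodge type `(2,2)` (i.e. `(A₁, K)`
is of Weil type, `K = ℚ(√-d)`), there exist a smooth projective complex abelian surface `(A₂, φ₂)`
with `φ₂ ≫ φ₂ = -(d • 𝟙 A₂)` OF WEIL TYPE — rendered on the carriers by a rational `(1,1)`-class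
`u₊ + u₋` of its Weil plane with both eigencomponents `u₊ ∈ E₊`, `u₋ ∈ E₋` non-zero — such that the
product sixfold `(A₁ × A₂, φ₁ × φ₂)` is of HYPERBOLIC (= split, discriminant `-1`) Weil type
(`Motives.IsHyperbolicWeilType`) for the `K`-symmetrised hyperplane class
`d · e^*a + (φ₁ × φ₂)^*(e^*a)` of some projective embedding `e` of `A₁ × A₂` and some non-zero
rational `a ∈ H²(ℙᴺ(ℂ); ℂ)`. Printed proof: the discriminant is multiplicative under products
(`Motives.weilDiscriminant_bilinOrthSum`), every class of `ℚ^×/Nm(K^×)` is the discriminant of a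
polarized abelian surface of Weil type (van Geemen 5.5, `Motives.exists_weilDiscriminant_eq`), so
`A₂` with `disc A₂ = -disc A₁` gives `disc (A₁ × A₂) = -1`, i.e. hyperbolic (Landherr, van Geemen
5.4; `Motives.weilDiscriminant_eq_of_isotropic_rat`).
[cite: Markman2025SurveySecant, §11.5 Step 2] [cite: vanGeemen1994HodgeAV, Lemma 5.2, 5.4 and 5.5]
[cite: Schoen1998HodgeWeilAddendum, §7] -/
def Markman2025_exists_weilTypeSurface_prod_isHyperbolicWeilType : Prop :=
  ∀ (d : ℕ), 0 < d → ∀ (A₁ : Motives.AbelianVariety ℂ) (φ₁ : A₁ ⟶ A₁), A₁.dim = 2 * 2 →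
    Motives.IsSmoothProjective (2 * 2) A₁.X → φ₁ ≫ φ₁ = -(d • 𝟙 A₁) →
      (∃ c : complexBetti A₁.X (2 * 2), IsRationalClass c ∧
        IsOfHodgeType (2 * 2) A₁.X (2 * 2) 2 2 c ∧ c ∈ weilClassesOf A₁ φ₁ 2 d ∧ c ≠ 0) →
      ∃ (A₂ : Motives.AbelianVariety ℂ) (φ₂ : A₂ ⟶ A₂), A₂.dim = 2 * 1 ∧
        Motives.IsSmoothProjective (2 * 1) A₂.X ∧ φ₂ ≫ φ₂ = -(d • 𝟙 A₂) ∧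
        (∃ up um : complexBetti A₂.X (2 * 1), up ∈ weilClassesPlus A₂ φ₂ 1 d ∧
          um ∈ weilClassesMinus A₂ φ₂ 1 d ∧ IsRationalClass (up + um) ∧
          IsOfHodgeType (2 * 1) A₂.X (2 * 1) 1 1 (up + um) ∧ up ≠ 0 ∧ um ≠ 0) ∧
        ∃ (e : Motives.ProjectiveEmbedding (A₁.prod A₂).X)
          (a : complexBetti (Motives.projectiveSpace e.n ℂ) 2), IsRationalClass a ∧ a ≠ 0 ∧
          Motives.IsHyperbolicWeilType (A₁.prod A₂)
            (Motives.AbelianVariety.prodLift (Motives.AbelianVariety.fst A₁ A₂ ≫ φ₁)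
              (Motives.AbelianVariety.snd A₁ A₂ ≫ φ₂)) 3
            ((d : ℂ) • complexBetti.map e.ι 2 a +
              complexBetti.map (Motives.AbelianVariety.prodLift
                (Motives.AbelianVariety.fst A₁ A₂ ≫ φ₁)
                (Motives.AbelianVariety.snd A₁ A₂ ≫ φ₂)).hom.hom.hom 2 (complexBetti.map e.ι 2 a))

/-- **Schoen's transfer (C. Schoen, Compositio Math. 114 (1998), §10 Proposition, pp. 332–333;
the "[schoen]" of Markman arXiv:2509.23403 §11.5 Step 2 and of the proof of arXiv:2502.03415
Cor. 1.6.1).** For `d ≥ 1`, a smooth projective complex abelian fourfold `(A₁, φ₁)` and a smooth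
projective complex abelian surface `(A₂, φ₂)` with `φᵢ ≫ φᵢ = -(d • 𝟙 Aᵢ)`, `A₂` of Weil type
(a rational `(1,1)`-class `u₊ + u₋` of its Weil plane with `u₊ ∈ E₊`, `u₋ ∈ E₋` both non-zero):
IF every rational class of Hodge type `(3,3)` in the Weil plane of the product sixfold
`(A₁ × A₂, φ₁ × φ₂)` is algebraic, THEN every rational class of Hodge type `(2,2)` in the Weil
plane `weilClassesOf A₁ φ₁ 2 d` is algebraic ("It follows that the Weil classes of `(A₁,η₁,h₁)`
are algebraic, by [schoen]"). Schoen's proof: for a Weil class `c = c₊ + c₋` of `A₁` the classes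
`pr₁^*c± ∪ pr₂^*u±` are Weil classes of the sixfold, hence algebraic, and
`pr_{1*}(z · pr₂^*D) = λ± · c±` with `λ± ≠ 0`; on the tree's carriers this is
`Markman2025_weilClasses_algebraic_abelianFourfold.pointwise_of_sixfold_partner` (file
`WeilClassesFourfoldsStep2`) relative to a `GysinFormalism`, the Hodge-type predicates
`PreservesHodgeType`/`CupPreservesHodgeType` and the two transfer scalars.
[cite: Schoen1998HodgeWeilAddendum, §10 (Proposition and proof, pp. 332–333)]
[cite: Markman2025SurveySecant, §11.5 Step 2] -/
def Schoen1998_weilClasses_algebraic_of_prod_surface : Prop :=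
  ∀ (d : ℕ), 0 < d → ∀ (A₁ : Motives.AbelianVariety ℂ) (φ₁ : A₁ ⟶ A₁)
    (A₂ : Motives.AbelianVariety ℂ) (φ₂ : A₂ ⟶ A₂), A₁.dim = 2 * 2 →
    Motives.IsSmoothProjective (2 * 2) A₁.X → φ₁ ≫ φ₁ = -(d • 𝟙 A₁) → A₂.dim = 2 * 1 →
    Motives.IsSmoothProjective (2 * 1) A₂.X → φ₂ ≫ φ₂ = -(d • 𝟙 A₂) →
      (∃ up um : complexBetti A₂.X (2 * 1), up ∈ weilClassesPlus A₂ φ₂ 1 d ∧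
        um ∈ weilClassesMinus A₂ φ₂ 1 d ∧ IsRationalClass (up + um) ∧
        IsOfHodgeType (2 * 1) A₂.X (2 * 1) 1 1 (up + um) ∧ up ≠ 0 ∧ um ≠ 0) →
      (∀ c : complexBetti (A₁.prod A₂).X (2 * 3), IsRationalClass c →
        IsOfHodgeType (2 * 3) (A₁.prod A₂).X (2 * 3) 3 3 c →
          c ∈ weilClassesOf (A₁.prod A₂)
            (Motives.AbelianVariety.prodLift (Motives.AbelianVariety.fst A₁ A₂ ≫ φ₁)
              (Motives.AbelianVariety.snd A₁ A₂ ≫ φ₂)) 3 d →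
          c ∈ algebraicClasses (A₁.prod A₂).X 3) →
      ∀ c : complexBetti A₁.X (2 * 2), IsRationalClass c →
        IsOfHodgeType (2 * 2) A₁.X (2 * 2) 2 2 c → c ∈ weilClassesOf A₁ φ₁ 2 d →
          c ∈ algebraicClasses A₁.X 2

/-- **Assembly (Markman arXiv:2509.23403 §11.5 Step 2, as printed).** Markman's Thm. 1.5.1 for
split sixfolds (`Markman2025_weilClasses_algebraic_hyperbolicSixfold`), the partner surface
(`Markman2025_exists_weilTypeSurface_prod_isHyperbolicWeilType`) and Schoen's transfer
(`Schoen1998_weilClasses_algebraic_of_prod_surface`) imply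
`Markman2025_weilClasses_algebraic_abelianFourfold`: for `c = 0` there is nothing to prove;
otherwise `c` witnesses that `(A₁, K)` is of Weil type, the partner `(A₂, φ₂)` makes
`(A₁ × A₂, φ₁ × φ₂)` a split sixfold (`dim = 6`, smooth projective, `(φ₁ × φ₂)² = -d` by
`dim_prod_eq_two_mul`, `isSmoothProjective_prod_two_mul`, `prodLift_comp_self_eq_neg_nsmul`), whose
rational `(3,3)` Weil classes are algebraic by Thm. 1.5.1, and Schoen's transfer concludes.
[cite: Markman2025SurveySecant, §11.5 Step 2] [cite: Markman2025SecantWeil, Cor. 1.6.1 (proof)] -/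
theorem Markman2025_weilClasses_algebraic_abelianFourfold_holds_of
    (h₁ : Markman2025_weilClasses_algebraic_hyperbolicSixfold)
    (h₂ : Markman2025_exists_weilTypeSurface_prod_isHyperbolicWeilType)
    (h₃ : Schoen1998_weilClasses_algebraic_of_prod_surface) :
    Markman2025_weilClasses_algebraic_abelianFourfold := by
  intro d hd A₁ φ₁ hA₁ hX₁ hφ₁ c hc h22 hW
  by_cases hc0 : c = 0
  · rw [hc0]; exact Submodule.zero_mem _
  obtain ⟨A₂, φ₂, hA₂, hX₂, hφ₂, hwt, e, a, ha, ha0, hhyp⟩ :=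
    h₂ d hd A₁ φ₁ hA₁ hX₁ hφ₁ ⟨c, hc, h22, hW, hc0⟩
  have hBdim : (A₁.prod A₂).dim = 2 * 3 := dim_prod_eq_two_mul hA₁ hA₂
  have hBX : Motives.IsSmoothProjective (2 * 3) (A₁.prod A₂).X :=
    isSmoothProjective_prod_two_mul hX₁ hX₂
  have hS6 := h₁ d hd (A₁.prod A₂) _ hBdim hBX (prodLift_comp_self_eq_neg_nsmul hφ₁ hφ₂) e a ha
    ha0 hhyp
  exact h₃ d hd A₁ φ₁ A₂ φ₂ hA₁ hX₁ hφ₁ hA₂ hX₂ hφ₂ hwt hS6 c hc h22 hW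

end HodgeTheory

end Literature.AlgebraicGeometry.HodgeTheory

end
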